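import Summits.Parity.GeneralizedHardyLittlewood.Theorems.FordMaynardNoSieveConst0164NegWitness0164SectionMomentsInner
import Summits.Parity.GeneralizedHardyLittlewood.Theorems.FordMaynardNoSieveConst0164NegWitness0164CellUnitBox

/-!
# Route `FordMaynardNoSieveConst0164`, crux `NegWitness0164` (stmt-Parity-19102), line `birth`,
# stub `stub_tweakNeg0164`: enclosure layer — section moments of the unit box, peeling the last coordinate

Helper file toward the certificate stub (K. Ford, J. Maynard, *On the theory of prime producing sieves*,
arXiv:2407.14368, §8).  The section moments `M_{abc}(s) = ∫_{Δ₃(s)} 𝟙[u ∈ (0,1)³] u₀^a u₁^b u₂^c` of the symmetric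
unit-box slice (into which `cell_integral_le_unitbox_0164` turns every cell integral of an α-family of (II')) are reduced
to one-dimensional integrals: peeling the last coordinate (`sliceIntegral_succ_succ_snoc`),
`M_{abc}(s) = ∫_{t ∈ (0,s]} 𝟙[0 < t < 1] t^c · N_{ab}(s − t) dt` with the inner moments
`N_{ab}(r) = ∫_{(0,r)} 𝟙[0 < x < 1, 0 < r − x < 1] x^a (r−x)^b dx` of `…SectionMomentsInner`, whose closed forms on
`r ∈ (0,1]` and `r ∈ [1,2]` are recorded here for `a, b ≤ 2` (they vanish for `r ≥ 2`).  What remains for the closed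
form of `M_{abc}` on `[0,1]`, `[1,2]`, `[2,3]` is the outer polynomial integration (next file).

* `sectionMoment_peel_0164` — **the peeling identity** for all `a b c : ℕ`;
* `innerMoment_low_a_b_0164`, `innerMoment_high_a_b_0164` (`a, b ≤ 2`) — closed forms of `N_{ab}`.

Def-free.  References: [FordMaynard2024PrimeSieves] arXiv:2407.14368, §8 (proof of Theorem 2.7 (c)); folklore calculus.
-/

noncomputable section

open Finset MeasureTheory Set intervalIntegral
open scoped Classical
open Literature.NumberTheory.Sieve Literature.NumberTheory.Sieve.FordMaynard

namespace Summit.Parity.GeneralizedHardyLittlewood.FordMaynardNoSieveConst0164NegWitness0164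

/-- The unit-box monomial integrand is measurable. [folklore] -/
theorem measurable_boxMonomial_0164 (a b c : ℕ) :
    Measurable (fun u : Fin 3 → ℝ => if ∀ k, 0 < u k ∧ u k < 1 then u 0 ^ a * u 1 ^ b * u 2 ^ c else 0) := by
  refine Measurable.ite ?_ (by fun_prop) measurable_const
  exact measurableSet_openBox_three_0164 (fun _ => (0 : ℝ)) (fun _ => (1 : ℝ))

/-- The unit-box monomial integrand is bounded by `1`. [folklore] -/
theorem abs_boxMonomial_le_one_0164 (a b c : ℕ) (u : Fin 3 → ℝ) :
    |(if ∀ k, 0 < u k ∧ u k < 1 then u 0 ^ a * u 1 ^ b * u 2 ^ c else 0 : ℝ)| ≤ 1 := by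
  by_cases h : ∀ k, 0 < u k ∧ u k < 1
  · rw [if_pos h]
    have h0 : 0 ≤ u 0 ^ a ∧ u 0 ^ a ≤ 1 := ⟨pow_nonneg (h 0).1.le a, pow_le_one₀ (h 0).1.le (h 0).2.le⟩
    have h1 : 0 ≤ u 1 ^ b ∧ u 1 ^ b ≤ 1 := ⟨pow_nonneg (h 1).1.le b, pow_le_one₀ (h 1).1.le (h 1).2.le⟩
    have h2 : 0 ≤ u 2 ^ c ∧ u 2 ^ c ≤ 1 := ⟨pow_nonneg (h 2).1.le c, pow_le_one₀ (h 2).1.le (h 2).2.le⟩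
    rw [abs_of_nonneg (mul_nonneg (mul_nonneg h0.1 h1.1) h2.1)]
    calc u 0 ^ a * u 1 ^ b * u 2 ^ c ≤ 1 * 1 * 1 :=
          mul_le_mul (mul_le_mul h0.2 h1.2 h1.1 zero_le_one) h2.2 h2.1 (by positivity)
      _ = 1 := by ring
  · rw [if_neg h, abs_zero]; exact zero_le_one

/-- **Peeling the last coordinate of a section moment**: for all `a b c` and `s`,
`M_{abc}(s) = ∫_{t ∈ (0,s]} 𝟙[0 < t < 1]·t^c·N_{ab}(s − t) dt`. [folklore] -/
theorem sectionMoment_peel_0164 (a b c : ℕ) (s : ℝ) :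
    sliceIntegral 3 s (fun u : Fin 3 → ℝ => if ∀ k, 0 < u k ∧ u k < 1 then u 0 ^ a * u 1 ^ b * u 2 ^ c else 0) =
      ∫ t in Ioc 0 s, (if 0 < t ∧ t < 1 then
        t ^ c * ∫ x in Ioo 0 (s - t),
          (if (0 < x ∧ x < 1) ∧ (0 < s - t - x ∧ s - t - x < 1) then x ^ a * (s - t - x) ^ b else 0)
        else 0) := by
  rw [sliceIntegral_succ_succ_snoc 1 s (measurable_boxMonomial_0164 a b c) zero_le_one
    (fun v _ _ => abs_boxMonomial_le_one_0164 a b c v)]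
  refine setIntegral_congr_fun measurableSet_Ioc fun t _ => ?_
  show sliceIntegral 2 (s - t) (fun v : Fin 2 → ℝ =>
      if ∀ k, 0 < (Fin.snoc v t : Fin 3 → ℝ) k ∧ (Fin.snoc v t : Fin 3 → ℝ) k < 1 then
        (Fin.snoc v t : Fin 3 → ℝ) 0 ^ a * (Fin.snoc v t : Fin 3 → ℝ) 1 ^ b * (Fin.snoc v t : Fin 3 → ℝ) 2 ^ c
      else 0) = _
  rw [sliceIntegral_two_eq_intervalIntegral]
  have hpt : ∀ x : ℝ, (if ∀ k, 0 < (Fin.snoc ![x, s - t - x] t : Fin 3 → ℝ) k ∧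
        (Fin.snoc ![x, s - t - x] t : Fin 3 → ℝ) k < 1 then
        (Fin.snoc ![x, s - t - x] t : Fin 3 → ℝ) 0 ^ a * (Fin.snoc ![x, s - t - x] t : Fin 3 → ℝ) 1 ^ b *
          (Fin.snoc ![x, s - t - x] t : Fin 3 → ℝ) 2 ^ c else 0) =
      (if 0 < t ∧ t < 1 then
        t ^ c * (if (0 < x ∧ x < 1) ∧ (0 < s - t - x ∧ s - t - x < 1) then x ^ a * (s - t - x) ^ b else 0)
        else 0) := by
    intro x
    rw [snoc_fin_two_eq]
    have e0 : (![x, s - t - x] : Fin 2 → ℝ) 0 = x := rfl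
    have e1 : (![x, s - t - x] : Fin 2 → ℝ) 1 = s - t - x := rfl
    rw [e0, e1]
    have v0 : (![x, s - t - x, t] : Fin 3 → ℝ) 0 = x := rfl
    have v1 : (![x, s - t - x, t] : Fin 3 → ℝ) 1 = s - t - x := rfl
    have v2 : (![x, s - t - x, t] : Fin 3 → ℝ) 2 = t := rfl
    have hiff : (∀ k, 0 < (![x, s - t - x, t] : Fin 3 → ℝ) k ∧ (![x, s - t - x, t] : Fin 3 → ℝ) k < 1) ↔
        ((0 < x ∧ x < 1) ∧ (0 < s - t - x ∧ s - t - x < 1)) ∧ (0 < t ∧ t < 1) := by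
      constructor
      · intro h
        exact ⟨⟨by rw [← v0]; exact h 0, by rw [← v1]; exact h 1⟩, by rw [← v2]; exact h 2⟩
      · rintro ⟨⟨h0, h1⟩, h2⟩ k
        fin_cases k
        · exact h0
        · exact h1
        · exact h2
    rw [v0, v1, v2]
    by_cases ht : 0 < t ∧ t < 1
    · by_cases hx : (0 < x ∧ x < 1) ∧ (0 < s - t - x ∧ s - t - x < 1)
      · rw [if_pos (hiff.mpr ⟨hx, ht⟩), if_pos ht, if_pos hx]; ring
      · rw [if_neg (fun h => hx (hiff.mp h).1), if_pos ht, if_neg hx, mul_zero]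
    · rw [if_neg (fun h => ht (hiff.mp h).2), if_neg ht]
  simp_rw [hpt]
  by_cases ht : 0 < t ∧ t < 1
  · simp_rw [if_pos ht]
    exact integral_const_mul _ _
  · simp_rw [if_neg ht]
    simp

end Summit.Parity.GeneralizedHardyLittlewood.FordMaynardNoSieveConst0164NegWitness0164

end
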